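import Summits.BirchSwinnertonDyer.BirchSwinnertonDyer.Theorems.RamifiedHeegnerPairLeafRankZeroUpperAtThreeShimuraInertCore
import Literature.NumberTheory.EllipticCurves.NonvanishingTwistsPrescribedInertSimpleZero
import HarnessLib

/-!
# Route `RamifiedHeegnerPair`, crux U₀ `LeafRankZeroUpperAtThree` (stmt-BirchSwinnertonDyer-26024), line `splitkolyvagin0` —
# the INERT-CARRIER (Shimura-curve) road for U₀, part 3: the field by Friedberg–Hoffstein (simple zero, inert set, `2` split), the
# partner's lower half from the DECIDING member L₁, and U₀ on a Shimura row from named facts ∧ L₁ — no Σ, no L₀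

HONEST FRAMING. Theorems only; helper file (`--supports stmt-BirchSwinnertonDyer-26024 --as helper`); nothing is booked, no item is
closed, BSD is not proved for any curve; CONDITIONAL on every displayed input. Lead prover bsd-line-rhp-p2 g10, 2026-08-28.

* `exists_goodPrime` — a prime of good reduction (any prime above the conductor).
* `partnerLowerSplitThreeRankOne_of_lowerRankOne` — at an odd imaginary quadratic field with `3` split whose twist has a simple zero, the
  minimal twist of a rank-ZERO leaf curve is a rank-ONE LEAF curve, so L₁ `Gss2LowerAtThreeRankOne` (item 26021, DECIDING) pays its lower half.
* `leafRankZeroUpper_three_of_shimuraInert_of_lowerRankOne` — **U₀ at a leaf curve (`r_an = 0`) on a Shimura row (datum with `3 ∤ c`, even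
  NONEMPTY inert set `S` of multiplicative primes holding every split-multiplicative carrier, SHAPE, (DEG)-availability) from the named facts
  {GZK, modularity ×2, Jacquet–Langlands, Pasten 2024 §6 component orders, CST14 + JSW17 on `X_{N⁺,N⁻}`, Friedberg–Hoffstein simple-zero
  inert-split (`friedbergHoffstein_exists_twist_simpleZero_inertAt_splitAt`)} ∧ L₁ — NO Σ★‴, NO L₀.** (U₀'s composition of record, v7:
  PUB₀⁺ → F1–F3 → Σ★‴ → L₁ → L₀ → U₀.) Census (rank-zero Gss2, `N < 5·10⁵`, memo §5): 51 of the 103 multi-carrier classes are Shimura rows.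

References: [cite: FriedbergHoffstein1995, Thm. B (second alternative)] [cite: JetchevSkinnerWan2017, §7.4.1–7.4.2, Thm. 4.4.1]
[cite: CaiShuTian2014, Thm. 1.5] [cite: PastenShimura2024, §6] [cite: GrossZagier1986, V.§2] [cite: Miller2011LMS, Def. 1.1].
-/

-- D-0017: single-problem summit, so `Summit.BirchSwinnertonDyer.BirchSwinnertonDyer.…` repeats a namespace BY DESIGN.
set_option linter.dupNamespace false
set_option autoImplicit false

noncomputable section

open scoped Classical NumberField

open WeierstrassCurve NumberField IsDedekindDomain Literature Literature.NumberTheory.EllipticCurves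
  Rat.HeightOneSpectrum CongruenceSubgroup
  Literature.NumberTheory.EllipticCurves.ModularForms
  Literature.NumberTheory.EllipticCurves.Rank1Residual
  Literature.NumberTheory.EllipticCurves.Rank1Residual.Typed
  Literature.NumberTheory.QuadraticFields.Quadratic
  Literature.NumberTheory.GaloisCohomology
  Literature.NumberTheory.Automorphic
  Summit.BirchSwinnertonDyer.Rank1Residual
  Summit.BirchSwinnertonDyer.Rank1Residual.Additive
  Summit.BirchSwinnertonDyer.Rank1Residual.X11b
  Summit.BirchSwinnertonDyer.Rank1Residual.X11b.Three
  Summit.BirchSwinnertonDyer.BirchSwinnertonDyer.Theses.RamifiedHeegnerPair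
  Summit.BirchSwinnertonDyer.BirchSwinnertonDyer.Theorems

namespace Summit.BirchSwinnertonDyer.BirchSwinnertonDyer.Theorems.LeafShimuraInert

/-! ## §U0.3 Helpers -/

/-- Every elliptic curve over `ℚ` has a prime of good reduction (any prime above the conductor). [folklore] -/
theorem exists_goodPrime (W : WeierstrassCurve ℚ) [W.IsElliptic] :
    ∃ p : ℕ, ∃ _ : Fact p.Prime, W.HasGoodReductionAtPrime p := by
  obtain ⟨p, hpN, hp⟩ := Nat.exists_infinite_primes (W.conductorNorm ℤ + 1)
  haveI : Fact p.Prime := ⟨hp⟩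
  refine ⟨p, inferInstance, ?_⟩
  by_contra hbad
  have hdvd : p ∣ W.conductorNorm ℤ := (W.dvd_conductorNorm_iff_not_hasGoodReductionAtPrime p).mpr hbad
  have hpos : 0 < W.conductorNorm ℤ := W.conductorNorm_pos_holds
  have := Nat.le_of_dvd hpos hdvd
  omega

/-- **The partner's lower half from L₁ `Gss2LowerAtThreeRankOne` (item 26021) BY NAME, swapped orientation.** For a non-CM leaf curve `W`,
an imaginary quadratic `K` of odd discriminant with `3` split whose twist has a SIMPLE zero, and every globally minimal model `Wd` of the twist:
`Wd` is a non-CM LEAF curve (`leaf_twist_of_split_three`) of analytic rank `1`, so L₁ pays `Typed.MissingLowerBoundAt Wd 3`.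
[cite: Miller2011LMS, Def. 1.1] [cite: Knapp1993, Prop. 12.10] -/
theorem partnerLowerSplitThreeRankOne_of_lowerRankOne (hmod : hasEntireLFunction_rat)
    (hL1 : Summit.BirchSwinnertonDyer.BirchSwinnertonDyer.Theses.RamifiedHeegnerPair.Gss2LowerAtThreeRankOne)
    (W : WeierstrassCurve ℚ) [W.IsElliptic] [W.IsGloballyMinimal]
    (hCM : ¬ W.HasCM) (hadd : Addv W 3) (hsub : SubGss W 3)
    (K : Type) [Field K] [NumberField K] (hK : IsImaginaryQuadratic K) (hodd : Odd (NumberField.discr K))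
    (hH3 : SatisfiesHeegnerHypothesis 3 K)
    (hLt0 : (W.quadraticTwist (NumberField.discr K : ℚ)).entireLFunction 1 = 0)
    (hLt1 : deriv (W.quadraticTwist (NumberField.discr K : ℚ)).entireLFunction 1 ≠ 0)
    (Wd : WeierstrassCurve ℚ) [Wd.IsElliptic] [Wd.IsGloballyMinimal] (Cd : VariableChange ℚ)
    (hWd : Cd • W.quadraticTwist (NumberField.discr K : ℚ) = Wd) :
    Typed.MissingLowerBoundAt Wd 3 := by
  obtain ⟨hCMd, haddd, hsubd, -⟩ := leaf_twist_of_split_three W hCM hadd hsub K hK hH3 hodd Wd Cd hWd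
  have hD0 : (NumberField.discr K : ℚ) ≠ 0 := by exact_mod_cast NumberField.discr_ne_zero K
  haveI : (W.quadraticTwist (NumberField.discr K : ℚ)).IsElliptic := W.isElliptic_quadraticTwist hD0
  have hrt : (W.quadraticTwist (NumberField.discr K : ℚ)).analyticRank = 1 :=
    analyticRank_eq_one_of_entireLFunction_one_eq_zero_of_deriv_ne_zero _ (hmod _) hLt0 hLt1
  have hrd : Wd.analyticRank = 1 := by rw [← hWd, analyticRank_smul, hrt]
  exact hL1 Wd hCMd haddd hsubd hrd

/-! ## §U0.4 U₀ on a Shimura row from named facts and L₁ -/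

/-- **U₀ AT A LEAF CURVE ON A «SHIMURA ROW», from PUBLISHED named facts and the deciding member L₁ — no Σ★‴, no L₀.** For `W/ℚ` globally
minimal, non-CM, additive of cell `(G) ∧ ss` at `3`, `r_an(W) = 0`, carrying a datum with `3 ∤ c`; a NONEMPTY even set `S` of multiplicative
primes holding every split-multiplicative carrier, SHAPE, (DEG)-availability: `Typed.MissingUpperBoundAt W 3` from {GZK, modularity, Jacquet–
Langlands, Pasten 2024 §6 component orders, `shimuraCurve_heegnerPoint_grossZagier_kolyvagin`, `friedbergHoffstein_exists_twist_simpleZero_inertAt_splitAt`}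
and L₁ `Gss2LowerAtThreeRankOne`. Field: root number `+1` (modularity, `r_an = 0`), `S` inert, every other bad prime split, `2` split when
`2 ∤ N` (so `d_K` odd), a good prime split, twist with a simple zero; Heegner datum by `shimuraHeegnerAt_of_fact`; core = part 2. CONDITIONAL;
nothing booked; U₀ / L₁ OPEN; BSD is not proved. [cite: FriedbergHoffstein1995, Thm. B] [cite: JetchevSkinnerWan2017, §7.4.1–7.4.2, Thm. 4.4.1]
[cite: CaiShuTian2014, Thm. 1.5] [cite: PastenShimura2024, Prop. 6.13, Lemmas 6.15–6.16, 6.18] [cite: Miller2011LMS, Def. 1.1] -/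
theorem leafRankZeroUpper_three_of_shimuraInert_of_lowerRankOne
    -- published inputs (named facts of the tree)
    (hGZK : rank_eq_analyticRank_of_analyticRank_le_one) (hmod : hasEntireLFunction_rat)
    (hnf : exists_isNewformOf) (hJL : nonempty_shimuraParametrizationData)
    (hCO : PastenShimura2024_componentOrders)
    (hHK : shimuraCurve_heegnerPoint_grossZagier_kolyvagin)
    (hFH1 : friedbergHoffstein_exists_twist_simpleZero_inertAt_splitAt)
    -- the route member L₁ BY NAME
    (hL1 : Summit.BirchSwinnertonDyer.BirchSwinnertonDyer.Theses.RamifiedHeegnerPair.Gss2LowerAtThreeRankOne)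
    -- the leaf curve (`r_an = 0`), with a datum whose constant is a `3`-unit
    (W : WeierstrassCurve ℚ) [W.IsElliptic] [W.IsGloballyMinimal]
    (hCM : ¬ W.HasCM) (hadd : Addv W 3) (hsub : SubGss W 3) (hr : W.analyticRank = 0)
    {N : ℕ} [NeZero N] (hN : W.conductorNorm ℤ = N)
    (Dt : ModularParametrizationData W N) (hc : ¬ (3 : ℤ) ∣ Dt.c)
    -- the inert set (nonempty), SHAPE and (DEG)-availability
    (S : Finset ℕ) (hSeven : Even S.card) (hSne : S.Nonempty)
    (hSmult : ∀ ℓ ∈ S, ∃ _ : Fact ℓ.Prime, W.HasMultiplicativeReductionAtPrime ℓ)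
    (hFC : ∀ (ℓ : ℕ) [Fact ℓ.Prime], ℓ ∉ S → W.HasSplitMultiplicativeReductionAtPrime ℓ →
      ¬ 3 ∣ padicValInt ℓ W.minimalDiscriminantInt)
    (hshape : ∀ (q : ℕ) [Fact q.Prime], 3 ∣ (W.baseChange ℚ_[q]).localTamagawaNumber ℤ_[q] →
      W.HasSplitMultiplicativeReductionAtPrime q)
    (hDEG : (∃ ℓ₀ ∈ S, ¬ 3 ∣ padicValInt ℓ₀ W.minimalDiscriminantInt) ∨
      (∃ ℓ₀ t : ℕ, ∃ _ : Fact ℓ₀.Prime, ∃ _ : Fact t.Prime,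
        W.HasMultiplicativeReductionAtPrime ℓ₀ ∧ W.HasMultiplicativeReductionAtPrime t ∧
        ℓ₀ ∉ S ∧ t ∉ S ∧ t ≠ ℓ₀ ∧ ¬ 3 ∣ padicValInt ℓ₀ W.minimalDiscriminantInt) ∨
      (∃ q₁ q₂ : ℕ, S = {q₁, q₂} ∧ q₁ ≠ q₂ ∧ q₂ ≠ 2 ∧ q₂ % 3 ≠ 1)) :
    Typed.MissingUpperBoundAt W 3 := by
  haveI h3F : Fact (Nat.Prime 3) := ⟨Nat.prime_three⟩
  have hp : (3 : ℕ).Prime := Nat.prime_three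
  subst hN
  have hirr : W.HasIrreducibleModPGaloisRep 3 := Additive.irr_of_subGss_of_ne_two W 3 (by decide) hadd hsub
  -- the sign of the functional equation is `+1` (modularity, `r_an = 0`)
  have hw : W.rootNumber = 1 := by
    rw [WeierstrassCurve.rootNumber_eq_neg_one_pow_analyticRank_of_exists_isNewformOf hnf W, hr]
    norm_num
  -- a good prime (to be split in the field; any will do)
  obtain ⟨p₀, hp₀F, hgood₀⟩ := exists_goodPrime W
  -- the field: `S` inert, every other bad prime split, `2` split when good, `p₀` split, the twist with a simple zero
  obtain ⟨K, _, _, hK, -, hinert, hsplitN, hsplit2, -, hLt0, hLt1⟩ := hFH1 W hw S hSmult hSeven hSne p₀ hgood₀ 4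
  have hodd : Odd (NumberField.discr K) := by
    by_cases h2S : 2 ∈ S
    · obtain ⟨hn, hd⟩ := hinert 2 h2S
      exact odd_discr_of_two_inert_or_split hK.1
        (Or.inl ⟨by simpa only [Nat.cast_ofNat] using hn, by simpa only [Nat.cast_ofNat] using hd⟩)
    · by_cases h2N : 2 ∣ W.conductorNorm ℤ
      · have hn := hsplitN 2 Nat.prime_two h2N h2S
        exact odd_discr_of_two_inert_or_split hK.1 (Or.inr (by simpa only [Nat.cast_ofNat] using hn))
      · exact odd_discr_of_two_inert_or_split hK.1 (Or.inr (hsplit2 h2N))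
  -- `3` splits (it is a bad prime outside `S`)
  have hbad3 : ¬ W.HasGoodReductionAtPrime 3 := not_good_of_addv W 3 hadd
  have h3S : 3 ∉ S := by
    intro h
    obtain ⟨_, hm⟩ := hSmult 3 h
    exact not_mult_of_addv W 3 hadd hm
  have h3N : 3 ∣ W.conductorNorm ℤ := (W.dvd_conductorNorm_iff_not_hasGoodReductionAtPrime 3).mpr hbad3
  have hps2 : ((Ideal.span {((3 : ℕ) : ℤ)}).primesOver (𝓞 K)).ncard = 2 := hsplitN 3 hp h3N h3S
  have hH3 : SatisfiesHeegnerHypothesis 3 K := fun q hq hq3 ↦ by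
    have : q = 3 := (Nat.prime_dvd_prime_iff_eq hq hp).mp hq3
    subst this; exact hps2
  -- the inert primes are `∥ N`
  have hSin : ∀ ℓ ∈ S, ℓ.Prime ∧ ℓ ∣ W.conductorNorm ℤ ∧ ¬ ℓ ^ 2 ∣ W.conductorNorm ℤ ∧
      ((Ideal.span {(ℓ : ℤ)}).primesOver (𝓞 K)).ncard = 1 ∧ ¬ (ℓ : ℤ) ∣ NumberField.discr K := by
    intro ℓ hℓ
    obtain ⟨hℓF, hm⟩ := hSmult ℓ hℓ
    obtain ⟨hn, hd⟩ := hinert ℓ hℓ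
    have hℓN : ℓ ∣ W.conductorNorm ℤ :=
      (W.dvd_conductorNorm_iff_not_hasGoodReductionAtPrime ℓ).mpr
        (WeierstrassCurve.HasMultiplicativeReduction.not_hasGoodReduction (R := ℤ_[ℓ]) hm)
    exact ⟨hℓF.out, hℓN, not_sq_dvd_conductorNorm_of_mult W ℓ hm, hn, hd⟩
  exact leafRankZeroUpper_three_of_shimuraInertDatum_at hGZK hmod hnf hJL hCO W hadd hsub hr rfl Dt hc S hSeven hSmult hFC hshape
    hDEG K hK hodd hinert hsplitN hLt0 hLt1
    (shimuraHeegnerAt_of_fact W rfl K hK S hSeven hSin hsplitN hps2 Dt hHK hirr)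
    (fun Wd _ _ Cd hWd ↦ partnerLowerSplitThreeRankOne_of_lowerRankOne hmod hL1 W hCM hadd hsub K hK hodd hH3 hLt0 hLt1 Wd Cd hWd)

end Summit.BirchSwinnertonDyer.BirchSwinnertonDyer.Theorems.LeafShimuraInert

end
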